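import Mathlib
import Summits.ValiantsHypothesis.ValiantsHypothesis.Theorems.RigidityForcesSymmetryRankRigidMinimalReprLaplaceFourDefs
import Summits.ValiantsHypothesis.ValiantsHypothesis.Theorems.RigidityForcesSymmetryRankRigidMinimalReprLaplaceFourPencil
import Summits.ValiantsHypothesis.ValiantsHypothesis.Theorems.RigidityForcesSymmetryRankRigidMinimalReprLaplaceFourContraction

/-!
# The pencil on a subspace of codimension `≤ 2` (resp. `≤ 3`) is not two (resp. one) rank-one products
# (crux `RankRigidMinimalRepr`, stmt-ValiantsHypothesis-18034, route `RigidityForcesSymmetry`)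

The two «easy» contradictions of the exact analysis of `LaplaceOptimal 4` (`…LaplaceFourPencil.lean`,
`…LaplaceFourContraction.lean`), stated on the pencil `M(t) = pencil t` alone:

* `pencil_codim_two_not_two_rank_one` — there is no subspace `K ⊆ ℂ⁴` cut out by two linear equations such that
  `M(ψ)` is a sum of two rank-one products for every `ψ ∈ K` (`K` contains an independent pair, and a plane is never
  inside the ten lines);
* `pencil_codim_three_not_rank_one` — nor one cut out by three equations with `M(ψ)` a single rank-one product on it
  (`K ≠ 0`, but a symmetric zero-diagonal rank-one matrix vanishes and `M(ψ) = 0` forces `ψ = 0`).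

After contracting two slots (`contract₀₁`, `φ = 𝟙`), a cheap decomposition of `P₄` with at most two (three) noise terms and
at most two (one) rank-one terms is exactly such a situation; this kills every profile with at least two slices
(`…LaplaceFourSlices.lean`).  HONEST FRAMING: finite linear algebra toward `LaplaceOptimal 4` (rung `TiedTorusBound 3`);
the crux stays OPEN; nothing here bears on `VP ≠ VNP`.
-/

set_option autoImplicit false

-- the mandated summit-side namespace repeats a component by design (single-problem summit)
set_option linter.dupNamespace false

namespace Summit.ValiantsHypothesis.ValiantsHypothesis.Theorems.RigidityForcesSymmetryRankRigidMinimalRepr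

namespace LaplaceFourEasy

open Module Matrix LaplaceFourPencil LaplaceFourContraction

/-! ### §1 Kernels of few linear conditions on `ℂ⁴` -/

/-- Two linear conditions on `ℂ⁴` leave a linearly independent pair of solutions. -/
theorem exists_indep_pair_of_two_conditions (A : Matrix (Fin 2) (Fin 4) ℂ) :
    ∃ ψ ψ' : Fin 4 → ℂ, LinearIndependent ℂ ![ψ, ψ'] ∧ A *ᵥ ψ = 0 ∧ A *ᵥ ψ' = 0 := by
  set L : (Fin 4 → ℂ) →ₗ[ℂ] (Fin 2 → ℂ) := Matrix.mulVecLin A with hL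
  have hrange : finrank ℂ (LinearMap.range L) ≤ 2 := by
    simpa using (LinearMap.range L).finrank_le
  have hsum := L.finrank_range_add_finrank_ker
  have h4 : finrank ℂ (Fin 4 → ℂ) = 4 := by simp
  have hker : 1 < finrank ℂ (LinearMap.ker L) := by omega
  obtain ⟨x, hx⟩ := (Module.finrank_pos_iff_exists_ne_zero (R := ℂ) (M := LinearMap.ker L)).1 (by omega)
  obtain ⟨y, hxy⟩ := exists_linearIndependent_pair_of_one_lt_finrank hker hx
  have hmap := hxy.map' (LinearMap.ker L).subtype (Submodule.ker_subtype _)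
  have hfun : (⇑(LinearMap.ker L).subtype ∘ ![x, y]) = ![(x : Fin 4 → ℂ), (y : Fin 4 → ℂ)] := by
    funext i; fin_cases i <;> rfl
  rw [hfun] at hmap
  exact ⟨x, y, hmap, x.2, y.2⟩

/-- Three linear conditions on `ℂ⁴` leave a non-zero solution. -/
theorem exists_ne_zero_of_three_conditions (A : Matrix (Fin 3) (Fin 4) ℂ) :
    ∃ ψ : Fin 4 → ℂ, ψ ≠ 0 ∧ A *ᵥ ψ = 0 := by
  set L : (Fin 4 → ℂ) →ₗ[ℂ] (Fin 3 → ℂ) := Matrix.mulVecLin A with hL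
  have hne : LinearMap.ker L ≠ ⊥ := LinearMap.ker_ne_bot_of_finrank_lt (by simp)
  obtain ⟨ψ, hψ, hne⟩ := Submodule.exists_mem_ne_zero_of_ne_bot hne
  exact ⟨ψ, hne, hψ⟩

/-! ### §2 The two easy contradictions -/

/-- **Codimension `≤ 2`, two rank-one products: impossible.**  If every solution `ψ` of two linear equations has
`pencil ψ = a bᵀ + a' b'ᵀ` for some vectors, we reach a contradiction (`pencil_plane_not_two_rank_one`). -/
theorem pencil_codim_two_not_two_rank_one (A : Matrix (Fin 2) (Fin 4) ℂ)
    (h : ∀ ψ : Fin 4 → ℂ, A *ᵥ ψ = 0 →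
      ∃ a b a' b' : Fin 4 → ℂ, pencil ψ = vecMulVec a b + vecMulVec a' b') : False := by
  obtain ⟨ψ, ψ', hind, hψ, hψ'⟩ := exists_indep_pair_of_two_conditions A
  refine pencil_plane_not_two_rank_one ψ ψ' hind fun μ => ?_
  have hμ : A *ᵥ (ψ + μ • ψ') = 0 := by rw [mulVec_add, mulVec_smul, hψ, hψ', smul_zero, add_zero]
  obtain ⟨a, b, a', b', hab⟩ := h _ hμ
  refine ⟨a, b, a', b', fun z w => ?_⟩
  have := congrFun (congrFun hab z) w
  simpa [pencil, vecMulVec_apply] using this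

/-- **Codimension `≤ 3`, one rank-one product: impossible.**  If every solution `ψ` of three linear equations has
`pencil ψ = a bᵀ`, we reach a contradiction (`symm_rank_one_eq_zero`, `pencil_eq_zero`). -/
theorem pencil_codim_three_not_rank_one (A : Matrix (Fin 3) (Fin 4) ℂ)
    (h : ∀ ψ : Fin 4 → ℂ, A *ᵥ ψ = 0 → ∃ a b : Fin 4 → ℂ, pencil ψ = vecMulVec a b) : False := by
  obtain ⟨ψ, hne, hψ⟩ := exists_ne_zero_of_three_conditions A
  obtain ⟨a, b, hab⟩ := h ψ hψ
  have hv : ∀ z w, pencil ψ z w = a z * b w := fun z w => by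
    rw [hab, vecMulVec_apply]
  have hsymm : ∀ z w : Fin 4, pencil ψ z w = pencil ψ w z := fun z w => by
    simp only [pencil, Matrix.of_apply]
    by_cases hzw : z = w
    · subst hzw; rfl
    · rw [if_neg hzw, if_neg (Ne.symm hzw)]; ring
  have h0 := symm_rank_one_eq_zero (fun z w => pencil ψ z w) a b hsymm (fun z => by simp [pencil]) hv
  have e : ∀ z w : Fin 4, z ≠ w → (∑ i, ψ i) - ψ z - ψ w = 0 := fun z w hzw => by
    have := h0 z w; simpa [pencil, hzw] using this
  have hT : ∑ i, ψ i = ψ 0 + ψ 1 + ψ 2 + ψ 3 := Fin.sum_univ_four ψ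
  apply hne
  refine pencil_eq_zero ψ ?_ ?_ ?_ ?_
  · have := e 0 1 (by decide); rw [hT] at this; linear_combination this
  · have := e 0 2 (by decide); rw [hT] at this; linear_combination this
  · have := e 1 2 (by decide); rw [hT] at this; linear_combination this
  · have := e 0 3 (by decide); rw [hT] at this; linear_combination this


/-! ### §3 Finset-indexed forms -/

/-- At most `k` linear conditions indexed by a finset come from a `k × 4` matrix. -/
theorem exists_matrix_of_card_le {ι : Type*} (s : Finset ι) {k : ℕ} (hs : s.card ≤ k) (ℓ : ι → Fin 4 → ℂ) :
    ∃ A : Matrix (Fin k) (Fin 4) ℂ, ∀ ψ : Fin 4 → ℂ, A *ᵥ ψ = 0 → ∀ t ∈ s, ∑ x, ℓ t x * ψ x = 0 := by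
  classical
  let e := s.equivFin
  refine ⟨Matrix.of fun i x => if h : (i : ℕ) < s.card then ℓ (e.symm ⟨i, h⟩ : s) x else 0, fun ψ hψ t ht => ?_⟩
  have hlt : ((Fin.castLE hs (e ⟨t, ht⟩) : Fin k) : ℕ) < s.card := by
    rw [Fin.val_castLE]; exact (e ⟨t, ht⟩).isLt
  have := congrFun hψ (Fin.castLE hs (e ⟨t, ht⟩))
  simp only [mulVec, dotProduct, Matrix.of_apply, Pi.zero_apply, dif_pos hlt] at this
  have hidx : e.symm ⟨((Fin.castLE hs (e ⟨t, ht⟩) : Fin k) : ℕ), hlt⟩ = ⟨t, ht⟩ := by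
    rw [Equiv.symm_apply_eq]; exact Fin.ext (by simp only [Fin.val_castLE])
  rw [hidx] at this
  exact this

/-- A sum of at most two rank-one products is (padded by zeros) exactly two rank-one products. -/
theorem sum_rank_one_of_card_le_two {ι : Type*} (R : Finset ι) (hR : R.card ≤ 2)
    (M : ι → Matrix (Fin 4) (Fin 4) ℂ) (hM : ∀ t ∈ R, ∃ c r : Fin 4 → ℂ, M t = vecMulVec c r) :
    ∃ a b a' b' : Fin 4 → ℂ, ∑ t ∈ R, M t = vecMulVec a b + vecMulVec a' b' := by
  classical
  have hzero : vecMulVec (0 : Fin 4 → ℂ) (0 : Fin 4 → ℂ) = 0 := by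
    ext i j; simp [vecMulVec_apply]
  rcases Nat.lt_or_ge R.card 1 with h0 | h1
  · have : R = ∅ := Finset.card_eq_zero.1 (show R.card = 0 by omega)
    exact ⟨0, 0, 0, 0, by rw [this, Finset.sum_empty, hzero, add_zero]⟩
  rcases Nat.lt_or_ge R.card 2 with h1' | h2
  · obtain ⟨t, rfl⟩ := Finset.card_eq_one.1 (show R.card = 1 by omega)
    obtain ⟨c, r, hc⟩ := hM t (Finset.mem_singleton_self t)
    exact ⟨c, r, 0, 0, by rw [Finset.sum_singleton, hc, hzero, add_zero]⟩
  · obtain ⟨t, t', hne, rfl⟩ := Finset.card_eq_two.1 (show R.card = 2 by omega)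
    obtain ⟨c, r, hc⟩ := hM t (by simp)
    obtain ⟨c', r', hc'⟩ := hM t' (by simp)
    exact ⟨c, r, c', r', by rw [Finset.sum_pair hne, hc, hc']⟩

/-- A sum of at most one rank-one product is one rank-one product. -/
theorem sum_rank_one_of_card_le_one {ι : Type*} (R : Finset ι) (hR : R.card ≤ 1)
    (M : ι → Matrix (Fin 4) (Fin 4) ℂ) (hM : ∀ t ∈ R, ∃ c r : Fin 4 → ℂ, M t = vecMulVec c r) :
    ∃ a b : Fin 4 → ℂ, ∑ t ∈ R, M t = vecMulVec a b := by
  classical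
  rcases Nat.lt_or_ge R.card 1 with h0 | h1
  · have : R = ∅ := Finset.card_eq_zero.1 (show R.card = 0 by omega)
    exact ⟨0, 0, by rw [this, Finset.sum_empty]; ext i j; simp [vecMulVec_apply]⟩
  · obtain ⟨t, rfl⟩ := Finset.card_eq_one.1 (show R.card = 1 by omega)
    obtain ⟨c, r, hc⟩ := hM t (Finset.mem_singleton_self t)
    exact ⟨c, r, by rw [Finset.sum_singleton, hc]⟩

/-! ### §4 Every easy profile is impossible -/

/-- **The easy profiles.**  A split-rank-one decomposition of `P₄` whose terms (in the canonical position, after a slot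
relabelling) are: noise terms `S_t ∈ {{0}, {0,1}}`, rank-one terms `S_t ∈ {{2}, {3}, {0,2}, {0,3}}`, no slice at slot `1`,
with (at most two noise and at most two rank-one terms) or (at most three noise and at most one rank-one term) — does
not exist.  Contract slots `0,1` against `ψ, 𝟙`: on the common kernel of the noise coefficients `pencil ψ` would be a sum
of the rank-one terms (`…LaplaceFourContraction.lean`), contradicting §2. -/
theorem easy_profile {ι : Type*} (T : Finset ι) (X : ι → (Fin 4 → Fin 4) → ℂ) (S : ι → Finset (Fin 4))
    (hX : ∀ t ∈ T, IsSplitTerm (S t) (X t))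
    (hS : ∀ t ∈ T, S t = {0} ∨ S t = {0, 1} ∨ S t = {2} ∨ S t = {3} ∨ S t = {0, 2} ∨ S t = {0, 3})
    (hsum : ∀ v, permPattern₄ v = ∑ t ∈ T, X t v)
    (hcount : ((T.filter fun t => S t = {0} ∨ S t = {0, 1}).card ≤ 2 ∧
        (T.filter fun t => ¬(S t = {0} ∨ S t = {0, 1})).card ≤ 2) ∨
      ((T.filter fun t => S t = {0} ∨ S t = {0, 1}).card ≤ 3 ∧
        (T.filter fun t => ¬(S t = {0} ∨ S t = {0, 1})).card ≤ 1)) : False := by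
  classical
  set N := T.filter fun t => S t = {0} ∨ S t = {0, 1} with hN
  set R := T.filter fun t => ¬(S t = {0} ∨ S t = {0, 1}) with hR
  -- noise coefficients (at `φ = 𝟙`) and their matrices
  have hnoise : ∀ t ∈ N, ∃ (ℓ : Fin 4 → ℂ) (M : Matrix (Fin 4) (Fin 4) ℂ), ∀ ψ : Fin 4 → ℂ,
      contract₀₁ (X t) ψ 1 = (∑ x, ℓ x * ψ x) • M := by
    intro t ht
    rw [hN, Finset.mem_filter] at ht
    obtain ⟨ht, hSt⟩ := ht
    obtain ⟨u, w, hu, hw, hX'⟩ := hX t ht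
    have hc : ∀ ψ φ, contract₀₁ (X t) ψ φ = contract₀₁ (fun v => u v * w v) ψ φ := fun ψ φ => contract_congr hX' ψ φ
    rcases hSt with hS0 | hS01
    · rw [hS0] at hu hw
      obtain ⟨ℓ, M, hM⟩ := contract_term_0 hu hw 1
      exact ⟨ℓ, M, fun ψ => by rw [hc, hM]⟩
    · rw [hS01] at hu hw
      obtain ⟨g, M, hM⟩ := contract_term_01 hu hw
      refine ⟨fun x => ∑ y, g x y, M, fun ψ => ?_⟩
      rw [hc, hM]
      congr 1
      refine Finset.sum_congr rfl fun x _ => ?_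
      rw [Finset.sum_mul]
      exact Finset.sum_congr rfl fun y _ => by simp only [Pi.one_apply, mul_one]; ring
  -- rank-one terms
  have hrank : ∀ t ∈ R, ∀ ψ : Fin 4 → ℂ, ∃ c r : Fin 4 → ℂ, contract₀₁ (X t) ψ 1 = vecMulVec c r := by
    intro t ht ψ
    rw [hR, Finset.mem_filter] at ht
    obtain ⟨ht, hSt⟩ := ht
    obtain ⟨u, w, hu, hw, hX'⟩ := hX t ht
    rw [contract_congr hX']
    rcases hS t ht with h0 | h01 | h2 | h3 | h02 | h03
    · exact absurd (Or.inl h0) hSt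
    · exact absurd (Or.inr h01) hSt
    · rw [h2] at hu hw
      obtain ⟨f, hf⟩ := contract_term_2 hu hw
      obtain ⟨r, hr⟩ := hf ψ 1
      exact ⟨f, r, hr⟩
    · rw [h3] at hu hw
      obtain ⟨f, hf⟩ := contract_term_3 hu hw
      obtain ⟨c, hc⟩ := hf ψ 1
      exact ⟨c, f, hc⟩
    · rw [h02] at hu hw
      obtain ⟨b, b', hb⟩ := contract_term_02 hu hw
      exact ⟨_, _, hb ψ 1⟩
    · rw [h03] at hu hw
      obtain ⟨c, c', hc⟩ := contract_term_03 hu hw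
      exact ⟨_, _, hc ψ 1⟩
  choose! ℓ M hℓ using hnoise
  -- on the common kernel, `pencil ψ` is the sum of the rank-one terms
  have key : ∀ ψ : Fin 4 → ℂ, (∀ t ∈ N, ∑ x, ℓ t x * ψ x = 0) →
      pencil ψ = ∑ t ∈ R, contract₀₁ (X t) ψ 1 := by
    intro ψ hψ
    rw [← contract_permPattern_one, contract_congr hsum, contract_sum]
    have hTNR : T = N ∪ R := by
      rw [hN, hR]; exact (Finset.filter_union_filter_not_eq _ T).symm
    have hdisj : Disjoint N R := by rw [hN, hR]; exact Finset.disjoint_filter_filter_not T T _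
    rw [hTNR, Finset.sum_union hdisj, Finset.sum_eq_zero (fun t ht => ?_), zero_add]
    rw [hℓ t ht, hψ t ht, zero_smul]
  rcases hcount with ⟨hN2, hR2⟩ | ⟨hN3, hR1⟩
  · obtain ⟨A, hA⟩ := exists_matrix_of_card_le N hN2 ℓ
    refine pencil_codim_two_not_two_rank_one A fun ψ hψ => ?_
    obtain ⟨a, b, a', b', hab⟩ := sum_rank_one_of_card_le_two R hR2 (fun t => contract₀₁ (X t) ψ 1)
      (fun t ht => hrank t ht ψ)
    exact ⟨a, b, a', b', by rw [key ψ (hA ψ hψ), hab]⟩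
  · obtain ⟨A, hA⟩ := exists_matrix_of_card_le N hN3 ℓ
    refine pencil_codim_three_not_rank_one A fun ψ hψ => ?_
    obtain ⟨a, b, hab⟩ := sum_rank_one_of_card_le_one R hR1 (fun t => contract₀₁ (X t) ψ 1)
      (fun t ht => hrank t ht ψ)
    exact ⟨a, b, by rw [key ψ (hA ψ hψ), hab]⟩

end LaplaceFourEasy

end Summit.ValiantsHypothesis.ValiantsHypothesis.Theorems.RigidityForcesSymmetryRankRigidMinimalRepr
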